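import Summits.RiemannHypothesis.RiemannHypothesis.Theorems.WeilGroundStateGroundStatesConvergeToXiEvenWitnessParity
import Summits.RiemannHypothesis.RiemannHypothesis.Theorems.OddSectorOddOneSignedWindowsRealPart
import Literature.NumberTheory.LFunctions.WeilResolventVectorExists
import Literature.NumberTheory.LFunctions.WeilWindowSimpleEven
import Literature.NumberTheory.LFunctions.WeilGroundState
import HarnessLib

/-!
# Stub `stub_rePart_groundState` of the line `Sketch`
(crux `WeilGroundState.GroundStatesConvergeToXi`, item stmt-RiemannHypothesis-1527, rev L8;
`--supports`, RH-free)

**The normalised real part of a ground state is a ground state.**  For the operator-free ground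
states `IsWeilGroundState a u` of Weil's truncated quadratic form (`L²`-limits of
`L²`-normalised minimising sequences `gₙ` of window test functions, `Re Q(gₙ) → ε(a)`): if
`Re u ≠ 0` in `L²`, then `Re u / ‖Re u‖₂` is a ground state at the same window.  This is the
closure property behind the REAL NORMAL FORM of the open stub of the line (real-valued even
ground states, the object class of Connes–van Suijlekom, Comm. Math. Phys. 406 (2025) Thm 6.1).

Mechanism (Weil's distribution is real), with the real/imaginary bookkeeping imported from the
tree file `OddSectorOddOneSignedWindowsRealPart.lean` (route `OddSector`, namespace
`…Theorems.OddSector`, where the same statement is proved for ODD-sector ground states):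
* `OddSector.re_weilQuadratic_eq_rePart_add_imPart` — for every test function `g` with real and
  imaginary parts `r = Re g`, `s = Im g` (real-valued test functions),
  `Re Q(g) = Re Q(r) + Re Q(s)`: the expansion of `Re Q` along the real line through `r` in the
  direction `i s` at `t = ±1` gives `Re Q(r + i s) + Re Q(r - i s) = 2 Re Q(r) + 2 Re Q(i s)`,
  while `r - i s = ḡ` has `Q(ḡ) = Q(g)` (`weilQuadratic_conj`: conjugation and reflection
  invariance of Weil's distribution) and `Q(i s) = Q(s)` (`weilQuadratic_const_mul`).
  Equivalently: the cross terms `-i W(r ⋆ s̃) + i W(s ⋆ r̃)` of the polarisation cancel because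
  `W` is real on real kernels.
* `OddSector.integral_norm_sq_rePart_add_imPart` — `∫‖Re f‖² + ∫‖Im f‖² = ∫‖f‖²` for `f ∈ L²`,
  and `‖Re z‖ ≤ ‖z‖` pointwise (`OddSector.norm_rePart_le`).
* `isWeilGroundState_rePart` — then verbatim the argument of `isWeilGroundState_evenPart`
  (`…EvenWitnessParity.lean`) with (real part, imaginary part) in place of (even part, odd part):
  along the minimising sequence `gₙ → u` with parts `eₙ = Re gₙ`, `oₙ = Im gₙ` (window test
  functions), `ε‖eₙ‖² ≤ Re Q(eₙ) ≤ Re Q(gₙ) − ε(1 − ‖eₙ‖²)`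
  (`weilGroundEnergy_mul_integral_norm_sq_le`), `‖eₙ − Re u‖₂ ≤ ‖gₙ − u‖₂ → 0`, so
  `‖eₙ‖² → ‖Re u‖² > 0`, `Re Q(eₙ) → ε‖Re u‖²`, and a tail of `eₙ/‖eₙ‖₂` is an `L²`-normalised
  minimising sequence converging to `Re u/‖Re u‖₂`.
* `stub_rePart_groundState` — the registered uncurried form; `isWeilGroundState_imPart` and
  `exists_real_isWeilGroundState` are the companion corollaries (`Im u = Re(−i u)` and the phase
  invariance `IsWeilGroundState.const_mul`; `∫‖Re u‖² + ∫‖Im u‖² = 1`).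

Mathlib + proved tree material only; no named fact; no definitions; standard axioms.

References: E. Bombieri, Rend. Lincei (9) 11 (2000) §§3–4 (the hermitian form `T[f * ḡ*]` is
real on real functions; Problem 2, Thm 3); H. Yoshida (1992) §2.
-/

set_option linter.dupNamespace false

noncomputable section

open MeasureTheory Complex Filter Set
open scoped Real Topology ComplexConjugate

namespace Summit.RiemannHypothesis.RiemannHypothesis.Theorems.GroundStatesConvergeToXi

open Literature.NumberTheory.LFunctions

/-! ### The normalised real part of a ground state is a ground state -/

/-- **The normalised real part of a ground state is a ground state.**  If `u` is a ground state
at the window `a` whose real part `Re u` is not `0` in `L²`, then `Re u/‖Re u‖₂` is a ground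
state at `a`.  Proof: for the minimising sequence `gₙ → u` with real/imaginary parts `eₙ, oₙ`
(window test functions), `Re Q(gₙ) = Re Q(eₙ) + Re Q(oₙ)` and `‖eₙ‖² + ‖oₙ‖² = 1`, so
`ε‖eₙ‖² ≤ Re Q(eₙ) ≤ Re Q(gₙ) − ε(1 − ‖eₙ‖²)`; `‖eₙ − Re u‖₂ ≤ ‖gₙ − u‖₂ → 0` gives
`‖eₙ‖² → ‖Re u‖² > 0` and `Re Q(eₙ) → ε‖Re u‖²`, whence `eₙ/‖eₙ‖₂` (eventually defined) is an
`L²`-normalised minimising sequence converging to `Re u/‖Re u‖₂`. [folklore] -/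
theorem isWeilGroundState_rePart {a : ℝ} {u : ℝ → ℂ} (hu : IsWeilGroundState a u)
    (hN : 0 < ∫ t, ‖(((u t).re : ℝ) : ℂ)‖ ^ 2) :
    IsWeilGroundState a (fun t ↦
      (((Real.sqrt (∫ s, ‖(((u s).re : ℝ) : ℂ)‖ ^ 2))⁻¹ : ℝ) : ℂ) * (((u t).re : ℝ) : ℂ)) := by
  -- adapted from `isWeilGroundState_evenPart` (`…EvenWitnessParity.lean`) and
  -- `OddSector.isWeilOddGroundState_rePart`: (even part, odd part) ↦ (real part, imaginary part)
  obtain ⟨hmem, g, hg, hQ, hL⟩ := hu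
  set N : ℝ := ∫ s, ‖(((u s).re : ℝ) : ℂ)‖ ^ 2 with hNdef
  set ε : ℝ := weilGroundEnergy a with hεdef
  -- real / imaginary parts of the minimising sequence and of `u`
  set e : ℕ → ℝ → ℂ := fun n t ↦ (((g n t).re : ℝ) : ℂ) with hedef
  set o : ℕ → ℝ → ℂ := fun n t ↦ (((g n t).im : ℝ) : ℂ) with hodef
  set ue : ℝ → ℂ := fun t ↦ (((u t).re : ℝ) : ℂ) with huedef
  have hgm : ∀ n, MemLp (g n) 2 := fun n ↦
    (hg n).1.1.continuous.memLp_of_hasCompactSupport (hg n).1.2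
  have het : ∀ n, IsWeilTest (e n) := fun n ↦ OddSector.isWeilTest_rePart (hg n).1
  have hot : ∀ n, IsWeilTest (o n) := fun n ↦ OddSector.isWeilTest_imPart (hg n).1
  have hes : ∀ n, tsupport (e n) ⊆ Icc (-a) a := fun n ↦
    (OddSector.tsupport_rePart_subset _).trans (hg n).2.1
  have hos : ∀ n, tsupport (o n) ⊆ Icc (-a) a := fun n ↦
    (OddSector.tsupport_imPart_subset _).trans (hg n).2.1
  have hem : ∀ n, MemLp (e n) 2 := fun n ↦ OddSector.memLp_rePart (hgm n)
  have huem : MemLp ue 2 := OddSector.memLp_rePart hmem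
  -- norms and energies split along real/imaginary parts
  set Ne : ℕ → ℝ := fun n ↦ ∫ t, ‖e n t‖ ^ 2 with hNedef
  have hsplit : ∀ n, Ne n + ∫ t, ‖o n t‖ ^ 2 = 1 := fun n ↦ by
    have := OddSector.integral_norm_sq_rePart_add_imPart (hgm n)
    rw [(hg n).2.2] at this
    exact this
  have hQsplit : ∀ n, (weilQuadratic (g n)).re =
      (weilQuadratic (e n)).re + (weilQuadratic (o n)).re := fun n ↦
    OddSector.re_weilQuadratic_eq_rePart_add_imPart (hg n).1
  have hlow : ∀ n, ε * Ne n ≤ (weilQuadratic (e n)).re := fun n ↦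
    weilGroundEnergy_mul_integral_norm_sq_le (het n) (hes n)
  have hupp : ∀ n, (weilQuadratic (e n)).re ≤ (weilQuadratic (g n)).re - ε * (1 - Ne n) := by
    intro n
    have h1 := weilGroundEnergy_mul_integral_norm_sq_le (hot n) (hos n)
    have h2 := hsplit n
    have h3 := hQsplit n
    have h4 : ∫ t, ‖o n t‖ ^ 2 = 1 - Ne n := by linarith
    rw [h4] at h1
    linarith
  -- `eₙ → Re u` in `L²`
  have hD : Tendsto (fun n ↦ ∫ t, ‖e n t - ue t‖ ^ 2) atTop (𝓝 0) := by
    refine squeeze_zero (fun n ↦ integral_nonneg fun _ ↦ by positivity) (fun n ↦ ?_) hL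
    refine integral_mono (integrable_norm_sq_of_memLp ((hem n).sub huem))
      (integrable_norm_sq_of_memLp ((hgm n).sub hmem)) fun t ↦ ?_
    have e1 : e n t - ue t = (((g n t - u t).re : ℝ) : ℂ) := by
      simp only [hedef, huedef, Complex.sub_re, Complex.ofReal_sub]
    dsimp only
    rw [e1]
    exact pow_le_pow_left₀ (norm_nonneg _) (OddSector.norm_rePart_le _) 2
  -- `‖eₙ‖² → N`
  have hNe : Tendsto Ne atTop (𝓝 N) := by
    have hsqrt : Tendsto (fun n ↦ Real.sqrt (∫ t, ‖e n t - ue t‖ ^ 2)) atTop (𝓝 0) := by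
      simpa using hD.sqrt
    set S : ℝ := Real.sqrt N with hS
    have h1 : ∀ n, Real.sqrt (Ne n) ≤ S + Real.sqrt (∫ t, ‖e n t - ue t‖ ^ 2) := fun n ↦ by
      have := sqrt_integral_norm_sq_sub_le huem (huem.sub (hem n))
      simpa only [Pi.sub_apply, sub_sub_cancel, norm_sub_rev (ue _)] using this
    have h2 : ∀ n, S ≤ Real.sqrt (Ne n) + Real.sqrt (∫ t, ‖e n t - ue t‖ ^ 2) := fun n ↦ by
      have := sqrt_integral_norm_sq_sub_le (hem n) ((hem n).sub huem)
      simpa only [Pi.sub_apply, sub_sub_cancel] using this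
    have h3 : Tendsto (fun n ↦ Real.sqrt (Ne n)) atTop (𝓝 S) := by
      have hup : Tendsto (fun n ↦ S + Real.sqrt (∫ t, ‖e n t - ue t‖ ^ 2)) atTop (𝓝 S) := by
        simpa using tendsto_const_nhds.add hsqrt
      have hlo : Tendsto (fun n ↦ S - Real.sqrt (∫ t, ‖e n t - ue t‖ ^ 2)) atTop (𝓝 S) := by
        simpa using tendsto_const_nhds.sub hsqrt
      exact tendsto_of_tendsto_of_tendsto_of_le_of_le hlo hup (fun n ↦ by linarith [h2 n])
        (fun n ↦ h1 n)
    have h4 : Tendsto (fun n ↦ Real.sqrt (Ne n) ^ 2) atTop (𝓝 (S ^ 2)) := h3.pow 2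
    have h5 : ∀ n, Real.sqrt (Ne n) ^ 2 = Ne n := fun n ↦
      Real.sq_sqrt (integral_nonneg fun _ ↦ by positivity)
    simp only [h5] at h4
    rwa [hS, Real.sq_sqrt hN.le] at h4
  -- `Re Q(eₙ) → ε N`
  have hQe : Tendsto (fun n ↦ (weilQuadratic (e n)).re) atTop (𝓝 (ε * N)) := by
    have hlo : Tendsto (fun n ↦ ε * Ne n) atTop (𝓝 (ε * N)) := tendsto_const_nhds.mul hNe
    have hup : Tendsto (fun n ↦ (weilQuadratic (g n)).re - ε * (1 - Ne n)) atTop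
        (𝓝 (ε * N)) := by
      have h1 : Tendsto (fun n ↦ ε * (1 - Ne n)) atTop (𝓝 (ε * (1 - N))) :=
        tendsto_const_nhds.mul (tendsto_const_nhds.sub hNe)
      have h2 := hQ.sub h1
      convert h2 using 2
      ring
    exact tendsto_of_tendsto_of_tendsto_of_le_of_le hlo hup hlow hupp
  -- eventually `‖eₙ‖² > N/2`
  obtain ⟨n₀, hn₀⟩ := eventually_atTop.1 (hNe.eventually (lt_mem_nhds (by linarith : N / 2 < N)))
  have hNepos : ∀ n, 0 < Ne (n + n₀) := fun n ↦ by
    have := hn₀ (n + n₀) (Nat.le_add_left _ _)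
    linarith
  -- the normalised real parts
  set r : ℕ → ℝ := fun n ↦ (Real.sqrt (Ne (n + n₀)))⁻¹ with hrdef
  set R : ℝ := (Real.sqrt N)⁻¹ with hRdef
  have hrpos : ∀ n, 0 < r n := fun n ↦ inv_pos.2 (Real.sqrt_pos.2 (hNepos n))
  have hr2 : ∀ n, r n ^ 2 = (Ne (n + n₀))⁻¹ := fun n ↦ by
    rw [hrdef]
    dsimp only
    rw [inv_pow, Real.sq_sqrt (hNepos n).le]
  have hrR : Tendsto r atTop (𝓝 R) :=
    ((hNe.comp (tendsto_add_atTop_nat n₀)).sqrt.inv₀ (Real.sqrt_ne_zero'.2 hN))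
  refine ⟨huem.const_mul _, fun n t ↦ ((r n : ℝ) : ℂ) * e (n + n₀) t, fun n ↦
    ⟨(het _).const_mul _, tsupport_mul_subset_right.trans (hes _), ?_⟩, ?_, ?_⟩
  · -- normalisation
    simp only [norm_mul, mul_pow, Complex.norm_real, Real.norm_of_nonneg (hrpos n).le]
    rw [integral_const_mul, hr2 n]
    exact inv_mul_cancel₀ (hNepos n).ne'
  · -- energies
    have key : ∀ n, (weilQuadratic (fun t ↦ ((r n : ℝ) : ℂ) * e (n + n₀) t)).re =
        (Ne (n + n₀))⁻¹ * (weilQuadratic (e (n + n₀))).re := fun n ↦ by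
      rw [weilQuadratic_const_mul, Complex.normSq_ofReal, Complex.re_ofReal_mul, ← sq, hr2 n]
    have h1 : Tendsto (fun n ↦ (Ne (n + n₀))⁻¹ * (weilQuadratic (e (n + n₀))).re) atTop
        (𝓝 (N⁻¹ * (ε * N))) :=
      ((hNe.comp (tendsto_add_atTop_nat n₀)).inv₀ hN.ne').mul
        (hQe.comp (tendsto_add_atTop_nat n₀))
    have h2 : N⁻¹ * (ε * N) = ε := by field_simp
    rw [h2] at h1
    exact h1.congr fun n ↦ (key n).symm
  · -- `L²` convergence to `R · Re u`
    have hD' : Tendsto (fun n ↦ ∫ t, ‖e (n + n₀) t - ue t‖ ^ 2) atTop (𝓝 0) :=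
      hD.comp (tendsto_add_atTop_nat n₀)
    have hNe' : Tendsto (fun n ↦ Ne (n + n₀)) atTop (𝓝 N) := hNe.comp (tendsto_add_atTop_nat n₀)
    have hpt : ∀ n t, ‖((r n : ℝ) : ℂ) * e (n + n₀) t - (R : ℂ) * ue t‖ ^ 2 ≤
        2 * (r n - R) ^ 2 * ‖e (n + n₀) t‖ ^ 2 + 2 * R ^ 2 * ‖e (n + n₀) t - ue t‖ ^ 2 := by
      intro n t
      have e1 : ((r n : ℝ) : ℂ) * e (n + n₀) t - (R : ℂ) * ue t =
          ((r n - R : ℝ) : ℂ) * e (n + n₀) t + (R : ℂ) * (e (n + n₀) t - ue t) := by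
        push_cast
        ring
      rw [e1]
      have h1 := norm_add_le (((r n - R : ℝ) : ℂ) * e (n + n₀) t)
        ((R : ℂ) * (e (n + n₀) t - ue t))
      rw [norm_mul, norm_mul, Complex.norm_real (r n - R), Complex.norm_real R,
        Real.norm_eq_abs (r n - R), Real.norm_eq_abs R] at h1
      have h2 : 0 ≤ |r n - R| * ‖e (n + n₀) t‖ := by positivity
      have h3 : 0 ≤ |R| * ‖e (n + n₀) t - ue t‖ := by positivity
      calc ‖((r n - R : ℝ) : ℂ) * e (n + n₀) t + (R : ℂ) * (e (n + n₀) t - ue t)‖ ^ 2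
          ≤ (|r n - R| * ‖e (n + n₀) t‖ + |R| * ‖e (n + n₀) t - ue t‖) ^ 2 :=
            pow_le_pow_left₀ (norm_nonneg _) h1 2
        _ ≤ 2 * (|r n - R| * ‖e (n + n₀) t‖) ^ 2 + 2 * (|R| * ‖e (n + n₀) t - ue t‖) ^ 2 := by
            nlinarith [sq_nonneg (|r n - R| * ‖e (n + n₀) t‖ - |R| * ‖e (n + n₀) t - ue t‖)]
        _ = 2 * (r n - R) ^ 2 * ‖e (n + n₀) t‖ ^ 2 + 2 * R ^ 2 * ‖e (n + n₀) t - ue t‖ ^ 2 := by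
            rw [mul_pow, mul_pow, sq_abs, sq_abs]; ring
    have hbound : ∀ n, ∫ t, ‖((r n : ℝ) : ℂ) * e (n + n₀) t - (R : ℂ) * ue t‖ ^ 2 ≤
        2 * (r n - R) ^ 2 * Ne (n + n₀) + 2 * R ^ 2 * ∫ t, ‖e (n + n₀) t - ue t‖ ^ 2 := by
      intro n
      have hi1 : Integrable fun t ↦ ‖e (n + n₀) t‖ ^ 2 := integrable_norm_sq_of_memLp (hem _)
      have hi2 : Integrable fun t ↦ ‖e (n + n₀) t - ue t‖ ^ 2 :=
        integrable_norm_sq_of_memLp ((hem _).sub huem)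
      have hi3 : Integrable fun t ↦
          2 * (r n - R) ^ 2 * ‖e (n + n₀) t‖ ^ 2 + 2 * R ^ 2 * ‖e (n + n₀) t - ue t‖ ^ 2 :=
        (hi1.const_mul (2 * (r n - R) ^ 2)).add (hi2.const_mul (2 * R ^ 2))
      have := integral_mono_of_nonneg (Eventually.of_forall fun t ↦ by positivity) hi3
        (Eventually.of_forall (hpt n))
      rw [integral_add (hi1.const_mul _) (hi2.const_mul _), integral_const_mul,
        integral_const_mul] at this
      exact this
    have hlim0 : Tendsto (fun n ↦ 2 * (r n - R) ^ 2 * Ne (n + n₀) +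
        2 * R ^ 2 * ∫ t, ‖e (n + n₀) t - ue t‖ ^ 2) atTop (𝓝 0) := by
      have h1 : Tendsto (fun n ↦ r n - R) atTop (𝓝 0) := by
        simpa using hrR.sub_const R
      have h2 : Tendsto (fun n ↦ 2 * (r n - R) ^ 2 * Ne (n + n₀)) atTop (𝓝 (2 * 0 ^ 2 * N)) :=
        (tendsto_const_nhds.mul (h1.pow 2)).mul hNe'
      have h3 : Tendsto (fun n ↦ 2 * R ^ 2 * ∫ t, ‖e (n + n₀) t - ue t‖ ^ 2) atTop
          (𝓝 (2 * R ^ 2 * 0)) :=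
        tendsto_const_nhds.mul hD'
      simpa using h2.add h3
    exact squeeze_zero (fun n ↦ integral_nonneg fun _ ↦ by positivity) hbound hlim0

/-- **Stub W1 — `rePart_groundState` (registered form; RH-free).**  The normalised REAL PART of
a ground state is a ground state: if `u` is a ground state at the window `a` and `Re u ≠ 0` in
`L²`, then `(Re u)/‖Re u‖₂` is a ground state at `a` (`isWeilGroundState_rePart`, uncurried).
[folklore] -/
theorem stub_rePart_groundState :
    ∀ (a : ℝ) (u : ℝ → ℂ), IsWeilGroundState a u →
      0 < ∫ t, ‖(((u t).re : ℝ) : ℂ)‖ ^ 2 →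
      IsWeilGroundState a (fun t =>
        (((Real.sqrt (∫ s, ‖(((u s).re : ℝ) : ℂ)‖ ^ 2))⁻¹ : ℝ) : ℂ) * (((u t).re : ℝ) : ℂ)) :=
  fun _ _ hu hN ↦ isWeilGroundState_rePart hu hN

/-! ### Corollaries: imaginary part; a real-valued ground state at the same window -/

/-- **The normalised imaginary part of a ground state is a ground state** (apply
`isWeilGroundState_rePart` to the ground state `−i·u` — phase invariance
`IsWeilGroundState.const_mul` — whose real part is `Im u`). [folklore] -/
theorem isWeilGroundState_imPart {a : ℝ} {u : ℝ → ℂ} (hu : IsWeilGroundState a u)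
    (hN : 0 < ∫ t, ‖(((u t).im : ℝ) : ℂ)‖ ^ 2) :
    IsWeilGroundState a (fun t ↦
      (((Real.sqrt (∫ s, ‖(((u s).im : ℝ) : ℂ)‖ ^ 2))⁻¹ : ℝ) : ℂ) * (((u t).im : ℝ) : ℂ)) := by
  have hu' : IsWeilGroundState a (fun t ↦ -I * u t) := hu.const_mul (by simp)
  have hre : ∀ t, (((-I * u t).re : ℝ) : ℂ) = (((u t).im : ℝ) : ℂ) := fun t ↦ by simp
  have h := isWeilGroundState_rePart hu' (by simpa only [hre] using hN)
  simpa only [hre] using h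

/-- **Every ground state yields a REAL-VALUED ground state at the same window**: its normalised
real part, or (if `Re u = 0` in `L²`) its normalised imaginary part
(`∫‖Re u‖² + ∫‖Im u‖² = ∫‖u‖² = 1`). [folklore] -/
theorem exists_real_isWeilGroundState {a : ℝ} {u : ℝ → ℂ} (hu : IsWeilGroundState a u) :
    ∃ v : ℝ → ℂ, IsWeilGroundState a v ∧ ∀ t, (v t).im = 0 := by
  have hsum := OddSector.integral_norm_sq_rePart_add_imPart hu.memLp
  rw [hu.integral_norm_sq] at hsum
  have h1 : 0 ≤ ∫ t, ‖(((u t).re : ℝ) : ℂ)‖ ^ 2 := integral_nonneg fun _ ↦ by positivity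
  rcases h1.eq_or_lt with hz | hpos
  · have hpos' : 0 < ∫ t, ‖(((u t).im : ℝ) : ℂ)‖ ^ 2 := by linarith
    exact ⟨_, isWeilGroundState_imPart hu hpos', fun t ↦ by simp [Complex.mul_im]⟩
  · exact ⟨_, isWeilGroundState_rePart hu hpos, fun t ↦ by simp [Complex.mul_im]⟩

end Summit.RiemannHypothesis.RiemannHypothesis.Theorems.GroundStatesConvergeToXi

end
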